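import Summits.Ventures.CertifiedManyBodySolver.Rows.FluxTorusSymmetries
import Summits.Ventures.CertifiedManyBodySolver.Rows.FluxTorusWindowGauge
import Literature.MathematicalPhysics.QuantumLattice.HubbardNNNHoppingWindowCertificate
import HarnessLib

/-!
# Torus ceiling, flux (twisted / anti-periodic) sectors — window certificates on `H_L(θ)`

(Parts I–III: `FluxTorusGaugeAut`, `FluxTorusSymmetries`, `FluxTorusWindowGauge`.)

HONEST FRAMING: first certified bounds; not a superconductivity verdict; every number certified or
labelled float. This file is the KERNEL TRANSPORT of a translation + EOM + charge-row window
certificate (Han 2020 / Kull–Schuch–Dive–Navascués 2024 shape, exactly the hypotheses of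
`Literature.MathematicalPhysics.QuantumLattice.groundEnergyAt_div_ge_of_window_certificate`, with
the SHARP admissibility `x ↦ x mod L` injective on the window `Λ'` itself) to EVERY flux sector of
the square-lattice Hubbard torus: for all `θ`,
`c − Σ‖aₖ‖ + (Σ_σ μ_σ)(n/L² − ν) ≤ minEnergyOn (hubbardTorusFlux L U θ) (szSector 2n 0) / L²`.
(`θ = π` is the anti-periodic torus that binds in the cell's TORUS FLOORS; PBC is `θ = 0`.)

Mechanism (Lieb 1994 gauge invariance + Han's translation averaging): work with the isospectral
uniform gauge `H_u = magneticHubbardTorus L (uniformTwistConfig L θ) 1 U`, which is translation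
invariant; pull the window identity back along `Φ = Ad(W_ĝ) ∘ Γ(ι)` where `ĝ` is the linear phase
`e^{iθx₁/L}` on the image of the window (trivial elsewhere). In the gauge `ĝ` the field is trivial on
every image bond, so `W_ĝᴴ H_u W_ĝ − hubbardTorus` is supported on non-image bonds and commutes
with the window algebra: EOM rows transport through the sharp periodic commutator lemma
(`Summit.HubbardSuperconductivity.ManyBodyBootstrap.hubbardTorus_commutator_fermionEmbed_sharp`).
Translation rows pick up a constant phase `e^{iθv₁/L}` (a power of the conserved `N̂`), charged
and residual words pick up unimodular phases, Gram / anti-Hermitian / density rows are invariant.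
No D4 (point-group) rows: the flux breaks them.

STATUS: kernel-checked, no `sorry`, no new axioms. Main results:
`fluxTorus_minEnergyOn_div_ge_of_window_certificate` (injectivity hypothesis) and
`fluxTorus_minEnergyOn_div_ge_of_window_certificate_of_spread` (finite check: coordinate spreads of
`Λ'` at most `M`, `L ≥ M + 1`, `L ≥ 3`). For a reduce-mode certificate with support box of side `D'`
this is the validity range `L ≥ max(3, D')` on EVERY flux sector — the kernel form of the cell's
torus-ceiling / torus-floor admissibility lemma (cal-3 `floor44/FLOOR-TORUS.md` §1, cal-1
`cal/RING-CEILING.md` §3 item 10), previously a refereed paper lemma. Consequence recorded by the cell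
(numbers are NOT tree objects): a translation+EOM(+charge) window certificate of support side `D' ≤ L`
cannot certify more than the certified anti-periodic `L×L` ground-state energy per site.

Tree inputs: `HubbardWindowCertificate.lean` (PP template and the `fermionEmbed_toTorusEmb_*` row
lemmas), `HubbardNNNHoppingWindowCertificate.lean` (`torus_minEnergyOn_div_ge_of_local_certificate`:
the translation-averaging engine for a general translation-invariant sector-preserving Hermitian `A`),
`MagneticHubbardTorus(Gauge).lean`, `HubbardTorusFluxGauge.lean` (flux ↔ uniform twist),
`BdGBondHamiltonian.lean` (`phaseGauge` letters), `FockRelabel.lean` (translations), pub-mbboot's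
`HubbardTorusCommutatorSharp.lean` (sharp periodic commutator). [cite: Han2020Bootstrap, §3]
[cite: KullEtAl2024, §5.3] [cite: Lieb1994, eq. (1)]
-/

noncomputable section

open Matrix Finset
open Literature.MathematicalPhysics.QuantumLattice
open Literature.MathematicalPhysics.QuantumFieldTheory hiding Site
open Literature.MathematicalPhysics.QuantumManyBody.StateRelaxation
open Literature.Probability.LatticeModels
open HubbardWave0
open scoped ComplexOrder ComplexConjugate

namespace Summit.Ventures.CertifiedManyBodySolver.Rows

section Window

variable {L : ℕ} [NeZero L]

/-! ### §5. The theorem: window certificate ⇒ every flux sector of the torus -/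

/-- **Window certificate ⇒ flux-sector energy per site (square lattice, every twist `θ`).** With
EXACTLY the data of `groundEnergyAt_div_ge_of_window_certificate` at `d = 2`, `t = 1` — a window
identity on `𝔄_{Λ'}` built from a Gram (SOS) term, EOM rows `[h_{Λ'}, Γ B]` (`B ∈ 𝔄_Λ`, `Λ'`
containing all neighbours of `Λ`), translation rows, charged ladder words, anti-Hermitian parts and
residual words — but the SHARP admissibility `x ↦ x mod L` injective on `Λ'` itself (`L ≥ M + 1` for
a window of side `M + 1`), the certified constant bounds the ground-energy density of EVERY flux
sector: `c − Σ‖aₖ‖ + (Σ_σ μ_σ)(n/L² − ν) ≤ minEnergyOn (hubbardTorusFlux L U θ) (szSector 2n 0) / L²`.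
Not covered (correctly): point-group rows. Han 2020 §3 / Kull et al. 2024 §5.3 certificates; Lieb 1994
(flux tori, gauge invariance). [cite: Han2020Bootstrap, §3] -/
theorem fluxTorus_minEnergyOn_div_ge_of_window_certificate (U θ : ℝ) (hL : 3 ≤ L) {nh : ℕ}
    (hn : nh ≤ Fintype.card (FermionTorus 2 L))
    {Λ Λ' : Finset (Site 2)} (hΛ : Λ ⊆ Λ')
    (hclosed : ∀ x ∈ Λ, ∀ i : Fin 2, x + unitVec i ∈ Λ' ∧ x - unitVec i ∈ Λ')
    (h0 : thicken ({0} : Finset (Site 2)) 1 ⊆ Λ') (hz : (0 : Site 2) ∈ Λ')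
    (hInj' : Set.InjOn (Torus.proj (d := 2) L) ↑Λ')
    (μ : Fin 2 → ℝ) (ν : ℝ)
    {m : Type*} [Fintype m] [DecidableEq m] {Λm : Matrix m m ℂ} (hΛm : Λm.PosSemidef)
    (O : m → FermionOp Λ')
    {κ : Type*} (s : Finset κ) (B : κ → FermionOp Λ)
    {ι : Type*} (tt : Finset ι) (v : ι → Site 2) (hsh : ∀ l, shiftSet (v l) Λ ⊆ Λ') (Y : ι → FermionOp Λ)
    {γ : Type*} (u : Finset γ) (b : γ → ℂ) (cw : γ → List (Orb (PolySite Λ') × Bool))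
    (hcw : ∀ j ∈ u, ladderCharge (cw j) ≠ 0 ∨ ladderSpinCharge (cw j) ≠ 0)
    {δ : Type*} (ah : Finset δ) (dc : δ → ℝ) (V : δ → FermionOp Λ')
    {κ'' : Type*} (w : Finset κ'') (a : κ'' → ℂ) (word : κ'' → List (Orb (PolySite Λ') × Bool)) {c : ℝ}
    (hcert : fermionEmbed (PolySite.incl h0) ((hubbardFermionInteraction 2 1 U).meanEnergyObs 1) -
        (c : ℂ) • (1 : FermionOp Λ') -
        ∑ σ : Fin 2, ((μ σ : ℝ) : ℂ) • (nAt 0 hz σ - ((ν : ℝ) : ℂ) • (1 : FermionOp Λ')) =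
      gramForm Λm O +
        (∑ k ∈ s, ((hubbardFermionInteraction 2 1 U).localHamiltonian Λ' * fermionEmbed (PolySite.incl hΛ) (B k) -
            fermionEmbed (PolySite.incl hΛ) (B k) * (hubbardFermionInteraction 2 1 U).localHamiltonian Λ') +
          ∑ l ∈ tt, (fermionEmbed (PolySite.incl (hsh l)) (fermionEmbed (PolySite.shiftEmb (v l) Λ) (Y l)) -
            fermionEmbed (PolySite.incl hΛ) (Y l)) +
          ∑ j ∈ u, b j • ladderWord (cw j)) +
        (∑ m' ∈ ah, ((dc m' : ℝ) : ℂ) • ((V m')ᴴ - V m') + ∑ k ∈ w, a k • ladderWord (word k))) :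
    c - ∑ k ∈ w, ‖a k‖ + (∑ σ : Fin 2, μ σ) * ((nh : ℝ) / (L : ℝ) ^ 2 - ν) ≤
      (hubbardTorusFlux L U θ).minEnergyOn (szSector (2 * nh) 0) / (L : ℝ) ^ 2 := by
  -- elaborate the torus identities below with the order-derived `DecidableEq`, as the tree's torus
  -- files (and Parts I–III) do; the statement itself does not depend on the instance.
  letI instDE : DecidableEq (FermionTorus 2 L) := LinearOrder.toDecidableEq
  have hInjΛ : Set.InjOn (Torus.proj (d := 2) L) ↑Λ := hInj'.mono (by exact_mod_cast hΛ)
  set ĝ : FermionTorus 2 L → Circle := fun u' => windowTwist L θ Λ' u'.toTorusSite with hĝ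
  set Γ' := fermionEmbed (PolySite.toTorusEmb L hInj') with hΓ'
  set ΓΛ := fermionEmbed (PolySite.toTorusEmb L hInjΛ) with hΓΛ
  set Φ : FermionOp Λ' →ₐ[ℂ] Matrix (Finset (Orb (FermionTorus 2 L))) (Finset (Orb (FermionTorus 2 L))) ℂ :=
    (gaugeAut ĝ).comp Γ' with hΦ
  have hΦapply : ∀ Zz, Φ Zz = gaugeAut ĝ (Γ' Zz) := fun _ => rfl
  set Hu := magneticHubbardTorus L (uniformTwistConfig L θ) 1 U with hHu
  set EΦ := (hubbardFermionInteraction 2 1 U).meanEnergyObs 1 with hEΦ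
  -- the flux torus is isospectral (sector by sector) to the uniformly twisted torus
  have hiso : (hubbardTorusFlux L U θ).minEnergyOn (szSector (2 * nh) 0) = Hu.minEnergyOn (szSector (2 * nh) 0) := by
    rw [hHu, magneticHubbardTorus_uniformTwistConfig_eq_conj_hubbardTorusFlux hL U θ,
      minEnergyOn_szSector_phaseGauge_conj]
  rw [hiso]
  -- Hamiltonian data
  have hA : Hu.IsHermitian := magneticHubbardTorus_isHermitian _ 1 U
  have hKA : ∀ ψ ∈ (szSector (2 * nh) 0 : Submodule ℂ (Fock (Orb (FermionTorus 2 L)))),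
      Hu *ᵥ ψ ∈ (szSector (2 * nh) 0 : Submodule ℂ (Fock (Orb (FermionTorus 2 L)))) :=
    fun ψ hψ => mulVec_magneticHubbardTorus_mem_szSector _ 1 U hψ
  have hTA : ∀ v' : TorusSite 2 L, (fockTranslate v').val * Hu = Hu * (fockTranslate v').val :=
    fun v' => fockTranslate_mul_magneticHubbardTorus_uniformTwistConfig v' θ 1 U
  -- the objective
  set X := Φ (fermionEmbed (PolySite.incl h0) EΦ) with hX
  have hsum : ∑ v' : TorusSite 2 L, (fockTranslate v').val * X * (fockTranslate v').valᴴ = Hu :=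
    sum_fockTranslate_gaugeAut_meanEnergyObs U θ h0 hInj'
  -- density observables (gauge invariant)
  set D : Fin 2 → Matrix (Finset (Orb (FermionTorus 2 L))) (Finset (Orb (FermionTorus 2 L))) ℂ :=
    fun σ => numberOp (FermionTorus.ofTorusSite (0 : TorusSite 2 L)) σ with hD
  set G : Fin 2 → Matrix (Finset (Orb (FermionTorus 2 L))) (Finset (Orb (FermionTorus 2 L))) ℂ :=
    fun σ => ∑ y : FermionTorus 2 L, numberOp y σ with hG
  have hDΓ : ∀ σ, Φ (nAt 0 hz σ) = D σ := fun σ => by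
    rw [hΦapply, hΓ', fermionEmbed_toTorusEmb_nAt_zero hz hInj' σ, gaugeAut_numberOp]
  have hDsum : ∀ σ ∈ (Finset.univ : Finset (Fin 2)),
      ∑ v' : TorusSite 2 L, (fockTranslate v').val * D σ * (fockTranslate v').valᴴ = G σ :=
    fun σ _ => sum_conj_fockTranslate_numberOp 0 σ
  have hGh : ∀ σ ∈ (Finset.univ : Finset (Fin 2)), (G σ).IsHermitian := fun σ _ => isHermitian_sum_numberOp σ
  have hGs : ∀ σ ∈ (Finset.univ : Finset (Fin 2)),
      ∀ ψ ∈ (szSector (2 * nh) 0 : Submodule ℂ (Fock (Orb (FermionTorus 2 L)))),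
        G σ *ᵥ ψ = (((nh : ℝ) : ℝ) : ℂ) • ψ := by
    intro σ _ ψ hψ
    rw [hG, spinNumber_mulVec_of_mem_szSector σ hψ]
    congr 1
    push_cast
    ring
  -- symmetry family: magnetic translations `T_{v mod L} e^{iθ v₁ N̂/L}`
  set Us : ι → Matrix (Finset (Orb (FermionTorus 2 L))) (Finset (Orb (FermionTorus 2 L))) ℂ :=
    fun l => (fockTranslate (Torus.proj L (v l))).val *
      phaseGauge (fun _ : FermionTorus 2 L => Circle.exp (θ / L * ((v l) 0 : ℝ))) with hUs
  set Yt : ι → Matrix (Finset (Orb (FermionTorus 2 L))) (Finset (Orb (FermionTorus 2 L))) ℂ :=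
    fun l => gaugeAut ĝ (ΓΛ (Y l)) with hYt
  have hU : ∀ l ∈ tt, Us l * Hu = Hu * Us l := fun l _ => by
    rw [hUs]
    dsimp only
    rw [Matrix.mul_assoc, phaseGauge_const_mul_magneticHubbardTorus, ← Matrix.mul_assoc, hTA,
      Matrix.mul_assoc]
  have hUK : ∀ l ∈ tt, ∀ ψ ∈ (szSector (2 * nh) 0 : Submodule ℂ (Fock (Orb (FermionTorus 2 L)))),
      Us l *ᵥ ψ ∈ (szSector (2 * nh) 0 : Submodule ℂ (Fock (Orb (FermionTorus 2 L)))) :=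
    fun l _ ψ hψ => by
      rw [hUs]; dsimp only; rw [← Matrix.mulVec_mulVec]
      exact fockTranslate_mulVec_mem_szSector _ (phaseGauge_mulVec_mem_szSector _ hψ)
  have hUK' : ∀ l ∈ tt, ∀ ψ ∈ (szSector (2 * nh) 0 : Submodule ℂ (Fock (Orb (FermionTorus 2 L)))),
      (Us l)ᴴ *ᵥ ψ ∈ (szSector (2 * nh) 0 : Submodule ℂ (Fock (Orb (FermionTorus 2 L)))) :=
    fun l _ ψ hψ => by
      rw [hUs]; dsimp only; rw [conjTranspose_mul, ← Matrix.mulVec_mulVec]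
      exact phaseGauge_conjTranspose_mulVec_mem_szSector _
        (fockTranslate_conjTranspose_mulVec_mem_szSector _ hψ)
  have hUU : ∀ l ∈ tt, (Us l)ᴴ * Us l = 1 := fun l _ => by
    rw [hUs]; dsimp only
    rw [conjTranspose_mul, Matrix.mul_assoc, ← Matrix.mul_assoc ((fockTranslate (Torus.proj L (v l))).valᴴ),
      fockTranslate_conjTranspose_mul_self, Matrix.one_mul, conjTranspose_phaseGauge_mul_self]
  -- charge family (charged words as commutators with `N̂` / `S^z`; the gauge phase joins the coefficient)
  set emb : Orb (PolySite Λ') × Bool → Orb (FermionTorus 2 L) × Bool :=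
    fun p => (Orb.embMap (PolySite.toTorusEmb L hInj') p.1, p.2) with hemb
  set ph : List (Orb (PolySite Λ') × Bool) → ℂ := fun l => (wordGauge ĝ (l.map emb) : ℂ) with hph
  set C : γ → Matrix (Finset (Orb (FermionTorus 2 L))) (Finset (Orb (FermionTorus 2 L))) ℂ :=
    fun j => if ladderCharge ((cw j).map emb) ≠ 0 then totalNumber else HubbardWave0.spinZ with hC
  set W : γ → Matrix (Finset (Orb (FermionTorus 2 L))) (Finset (Orb (FermionTorus 2 L))) ℂ :=
    fun j => ((b j * ph (cw j)) / (if ladderCharge ((cw j).map emb) ≠ 0 then ((ladderCharge ((cw j).map emb) : ℤ) : ℂ)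
      else ((ladderSpinCharge ((cw j).map emb) : ℤ) : ℂ) / 2)) • ladderWord ((cw j).map emb) with hW
  have hC1 : ∀ j ∈ u, C j * Hu = Hu * C j := by
    intro j _
    by_cases hq : ladderCharge ((cw j).map emb) ≠ 0
    · simp only [hC, hq, ne_eq, not_false_eq_true, if_true]
      exact (magneticHubbardTorus_commute_totalNumber _ 1 U).symm.eq
    · simp only [hC, hq, if_false]
      exact (magneticHubbardTorus_commute_spinZ _ 1 U).symm.eq
  have hCK : ∀ j ∈ u, ∀ ψ ∈ (szSector (2 * nh) 0 : Submodule ℂ (Fock (Orb (FermionTorus 2 L)))),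
      C j *ᵥ ψ ∈ (szSector (2 * nh) 0 : Submodule ℂ (Fock (Orb (FermionTorus 2 L)))) := by
    intro j _ ψ hψ
    obtain ⟨hNψ, hSψ⟩ := (mem_szSector_iff _ _ ψ).1 hψ
    by_cases hq : ladderCharge ((cw j).map emb) ≠ 0
    · simp only [hC, hq, ne_eq, not_false_eq_true, if_true]
      rw [totalNumber_mulVec_of_isNParticle hNψ]
      exact Submodule.smul_mem _ _ hψ
    · simp only [hC, hq, if_false]
      rw [hSψ]
      exact Submodule.smul_mem _ _ hψ
  have hCh : ∀ j, (C j)ᴴ = C j := by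
    intro j
    by_cases hq : ladderCharge ((cw j).map emb) ≠ 0
    · simp only [hC, hq, ne_eq, not_false_eq_true, if_true]
      rw [totalNumber_eq_numberDiag_univ]
      exact numberDiag_conjTranspose _
    · simp only [hC, hq, if_false]; exact HubbardWave0.spinZ_isHermitian.eq
  have hCK' : ∀ j ∈ u, ∀ ψ ∈ (szSector (2 * nh) 0 : Submodule ℂ (Fock (Orb (FermionTorus 2 L)))),
      (C j)ᴴ *ᵥ ψ ∈ (szSector (2 * nh) 0 : Submodule ℂ (Fock (Orb (FermionTorus 2 L)))) :=
    fun j hj ψ hψ => by rw [hCh j]; exact hCK j hj ψ hψ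
  have hcharged : ∀ j ∈ u, Φ (b j • ladderWord (cw j)) = C j * W j - W j * C j := by
    intro j hj
    rw [map_smul, hΦapply, hΓ', fermionEmbed_ladderWord, gaugeAut_ladderWord, smul_smul]
    have hl : ladderCharge ((cw j).map emb) ≠ 0 ∨ ladderSpinCharge ((cw j).map emb) ≠ 0 := by
      rw [hemb, ladderCharge_map_embMap, ladderSpinCharge_map_embMap]; exact hcw j hj
    exact smul_ladderWord_eq_commutator_of_charged (b j * ph (cw j)) _ hl
  -- residual words (the gauge phase joins the coefficient; it is unimodular)
  set M : κ'' → Matrix (Finset (Orb (FermionTorus 2 L))) (Finset (Orb (FermionTorus 2 L))) ℂ :=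
    fun k => ladderWord ((word k).map emb) with hM
  set a' : κ'' → ℂ := fun k => a k * ph (word k) with ha'
  have hMc : ∀ k ∈ w, (M k).IsContraction := fun k _ => by
    rw [hM]; dsimp only; rw [ladderWord_eq_prod]; exact isContraction_prod_ladder _
  have hnorm : ∑ k ∈ w, ‖a' k‖ = ∑ k ∈ w, ‖a k‖ :=
    Finset.sum_congr rfl fun k _ => by rw [ha']; dsimp only; rw [norm_mul, hph]; dsimp only; rw [norm_wordGauge, mul_one]
  -- the identity, pulled back into the twisted torus
  have htorus : X - (c : ℂ) • (1 : Matrix (Finset (Orb (FermionTorus 2 L))) (Finset (Orb (FermionTorus 2 L))) ℂ) -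
      ∑ σ ∈ (Finset.univ : Finset (Fin 2)), ((μ σ : ℝ) : ℂ) • (D σ - ((ν : ℝ) : ℂ) •
        (1 : Matrix (Finset (Orb (FermionTorus 2 L))) (Finset (Orb (FermionTorus 2 L))) ℂ)) =
      gramForm Λm (fun i => Φ (O i)) +
        (∑ k ∈ s, (Hu * Φ (fermionEmbed (PolySite.incl hΛ) (B k)) - Φ (fermionEmbed (PolySite.incl hΛ) (B k)) * Hu) +
          ∑ l ∈ tt, (Us l * Yt l * (Us l)ᴴ - Yt l) +
          ∑ i ∈ (∅ : Finset (Fin 0)), ((0 : Matrix _ _ ℂ) * ((0 : Matrix _ _ ℂ) - (((0 : ℝ) : ℝ) : ℂ) • 1) +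
            ((0 : Matrix _ _ ℂ) - (((0 : ℝ) : ℝ) : ℂ) • 1) * (0 : Matrix _ _ ℂ)) +
          ∑ j ∈ u, (C j * W j - W j * C j)) +
        (∑ m' ∈ ah, ((dc m' : ℝ) : ℂ) • ((Φ (V m'))ᴴ - Φ (V m')) + ∑ k ∈ w, a' k • M k) := by
    have key := congrArg Φ hcert
    -- left-hand side
    rw [map_sub, map_sub, map_smul, map_one, map_sum] at key
    have hlhs : ∑ σ : Fin 2, Φ (((μ σ : ℝ) : ℂ) • (nAt 0 hz σ - ((ν : ℝ) : ℂ) • (1 : FermionOp Λ'))) =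
        ∑ σ ∈ (Finset.univ : Finset (Fin 2)), ((μ σ : ℝ) : ℂ) • (D σ - ((ν : ℝ) : ℂ) •
          (1 : Matrix (Finset (Orb (FermionTorus 2 L))) (Finset (Orb (FermionTorus 2 L))) ℂ)) :=
      Finset.sum_congr rfl fun σ _ => by rw [map_smul, map_sub, map_smul, map_one, hDΓ]
    rw [hlhs] at key
    -- right-hand side, family by family
    have h1 : Φ (∑ k ∈ s, ((hubbardFermionInteraction 2 1 U).localHamiltonian Λ' * fermionEmbed (PolySite.incl hΛ) (B k) -
        fermionEmbed (PolySite.incl hΛ) (B k) * (hubbardFermionInteraction 2 1 U).localHamiltonian Λ')) =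
        ∑ k ∈ s, (Hu * Φ (fermionEmbed (PolySite.incl hΛ) (B k)) - Φ (fermionEmbed (PolySite.incl hΛ) (B k)) * Hu) := by
      rw [map_sum]
      refine Finset.sum_congr rfl fun k _ => ?_
      rw [hΦapply, hΦapply, hHu, hΓ', hĝ]
      exact (magneticHubbardTorus_commutator_gaugeAut_fermionEmbed hL U θ hΛ hclosed hInj' (B k)).symm
    have h2 : Φ (∑ l ∈ tt, (fermionEmbed (PolySite.incl (hsh l)) (fermionEmbed (PolySite.shiftEmb (v l) Λ) (Y l)) -
        fermionEmbed (PolySite.incl hΛ) (Y l))) = ∑ l ∈ tt, (Us l * Yt l * (Us l)ᴴ - Yt l) := by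
      rw [map_sum]
      refine Finset.sum_congr rfl fun l _ => ?_
      rw [hUs, hYt, hΓΛ, hΦapply, hΓ', hĝ]
      exact gaugeAut_fermionEmbed_shift_sub θ hΛ (v l) (hsh l) hInj' (Y l)
    have h3 : Φ (∑ j ∈ u, b j • ladderWord (cw j)) = ∑ j ∈ u, (C j * W j - W j * C j) := by
      rw [map_sum]
      exact Finset.sum_congr rfl hcharged
    have h4 : Φ (∑ m' ∈ ah, ((dc m' : ℝ) : ℂ) • ((V m')ᴴ - V m')) =
        ∑ m' ∈ ah, ((dc m' : ℝ) : ℂ) • ((Φ (V m'))ᴴ - Φ (V m')) := by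
      rw [map_sum]
      refine Finset.sum_congr rfl fun m' _ => ?_
      rw [map_smul, map_sub, hΦapply, hΦapply, hΓ', fermionEmbed_conjTranspose, gaugeAut_conjTranspose]
    have h5 : Φ (∑ k ∈ w, a k • ladderWord (word k)) = ∑ k ∈ w, a' k • M k := by
      rw [map_sum]
      refine Finset.sum_congr rfl fun k _ => ?_
      rw [map_smul, hM, ha', hΦapply, hΓ', fermionEmbed_ladderWord, gaugeAut_ladderWord, smul_smul]
    have h0' : Φ (gramForm Λm O) = gramForm Λm (fun i => Φ (O i)) := by
      rw [hΦapply, hΓ', fermionEmbed_gramForm, gaugeAut_gramForm]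
      rfl
    rw [hX, key, map_add, map_add, map_add, map_add, map_add, h0', h1, h2, h3, h4, h5,
      Finset.sum_empty, add_zero]
  -- apply the torus theorem
  have hmain := torus_minEnergyOn_div_ge_of_local_certificate Hu hA hn hKA hTA X hsum
    (Finset.univ : Finset (Fin 2)) μ (fun _ => ν) (fun _ => (nh : ℝ)) D G hDsum hGh hGs hΛm
    (fun i => Φ (O i)) s (fun k => Φ (fermionEmbed (PolySite.incl hΛ) (B k))) tt Us Yt hU hUK hUK' hUU
    (∅ : Finset (Fin 0)) (fun _ => 0) (fun _ => 0) (fun _ => 0) (fun _ => 0)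
    (fun i hi => absurd hi (Finset.notMem_empty i)) (fun i hi => absurd hi (Finset.notMem_empty i))
    u C W hC1 hCK hCK' ah dc (fun m' => Φ (V m')) w a' M hMc htorus
  have hs : ∑ σ ∈ (Finset.univ : Finset (Fin 2)), μ σ * ((nh : ℝ) / (L : ℝ) ^ 2 - ν) =
      (∑ σ : Fin 2, μ σ) * ((nh : ℝ) / (L : ℝ) ^ 2 - ν) := by rw [Finset.sum_mul]
  rw [hs, hnorm] at hmain
  exact hmain

/-- **The flux-torus threshold as a finite check.** As
`fluxTorus_minEnergyOn_div_ge_of_window_certificate`, with the injectivity of `x ↦ x mod L` on `Λ'`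
replaced by: all coordinate spreads of `Λ'` are at most `M` and `L ≥ M + 1`
(`Torus.proj_injective_of_abs_sub_lt`). For the support box of side `D'` of a reduce-mode certificate
(`M = D' − 1`) the bound holds on every flux sector of every `L×L` torus with `L ≥ max(3, D')`, every
`n ≤ L²`. [cite: Han2020Bootstrap, §3] -/
theorem fluxTorus_minEnergyOn_div_ge_of_window_certificate_of_spread (U θ : ℝ) (hL : 3 ≤ L)
    {M : ℕ} (hLM : M + 1 ≤ L) {nh : ℕ} (hn : nh ≤ Fintype.card (FermionTorus 2 L))
    {Λ Λ' : Finset (Site 2)} (hΛ : Λ ⊆ Λ')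
    (hspread : ∀ x ∈ Λ', ∀ y ∈ Λ', ∀ j, |x j - y j| ≤ (M : ℤ))
    (hclosed : ∀ x ∈ Λ, ∀ i : Fin 2, x + unitVec i ∈ Λ' ∧ x - unitVec i ∈ Λ')
    (h0 : thicken ({0} : Finset (Site 2)) 1 ⊆ Λ') (hz : (0 : Site 2) ∈ Λ')
    (μ : Fin 2 → ℝ) (ν : ℝ)
    {m : Type*} [Fintype m] [DecidableEq m] {Λm : Matrix m m ℂ} (hΛm : Λm.PosSemidef)
    (O : m → FermionOp Λ')
    {κ : Type*} (s : Finset κ) (B : κ → FermionOp Λ)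
    {ι : Type*} (tt : Finset ι) (v : ι → Site 2) (hsh : ∀ l, shiftSet (v l) Λ ⊆ Λ') (Y : ι → FermionOp Λ)
    {γ : Type*} (u : Finset γ) (b : γ → ℂ) (cw : γ → List (Orb (PolySite Λ') × Bool))
    (hcw : ∀ j ∈ u, ladderCharge (cw j) ≠ 0 ∨ ladderSpinCharge (cw j) ≠ 0)
    {δ : Type*} (ah : Finset δ) (dc : δ → ℝ) (V : δ → FermionOp Λ')
    {κ'' : Type*} (w : Finset κ'') (a : κ'' → ℂ) (word : κ'' → List (Orb (PolySite Λ') × Bool)) {c : ℝ}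
    (hcert : fermionEmbed (PolySite.incl h0) ((hubbardFermionInteraction 2 1 U).meanEnergyObs 1) -
        (c : ℂ) • (1 : FermionOp Λ') -
        ∑ σ : Fin 2, ((μ σ : ℝ) : ℂ) • (nAt 0 hz σ - ((ν : ℝ) : ℂ) • (1 : FermionOp Λ')) =
      gramForm Λm O +
        (∑ k ∈ s, ((hubbardFermionInteraction 2 1 U).localHamiltonian Λ' * fermionEmbed (PolySite.incl hΛ) (B k) -
            fermionEmbed (PolySite.incl hΛ) (B k) * (hubbardFermionInteraction 2 1 U).localHamiltonian Λ') +
          ∑ l ∈ tt, (fermionEmbed (PolySite.incl (hsh l)) (fermionEmbed (PolySite.shiftEmb (v l) Λ) (Y l)) -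
            fermionEmbed (PolySite.incl hΛ) (Y l)) +
          ∑ j ∈ u, b j • ladderWord (cw j)) +
        (∑ m' ∈ ah, ((dc m' : ℝ) : ℂ) • ((V m')ᴴ - V m') + ∑ k ∈ w, a k • ladderWord (word k))) :
    c - ∑ k ∈ w, ‖a k‖ + (∑ σ : Fin 2, μ σ) * ((nh : ℝ) / (L : ℝ) ^ 2 - ν) ≤
      (hubbardTorusFlux L U θ).minEnergyOn (szSector (2 * nh) 0) / (L : ℝ) ^ 2 := by
  have hInj' : Set.InjOn (Torus.proj (d := 2) L) ↑Λ' := by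
    intro x hx y hy hxy
    have hML : (M : ℤ) < L := by exact_mod_cast (show M < L by omega)
    exact Torus.proj_injective_of_abs_sub_lt
      (fun j => lt_of_le_of_lt (hspread x (Finset.mem_coe.1 hx) y (Finset.mem_coe.1 hy) j) hML) hxy
  exact fluxTorus_minEnergyOn_div_ge_of_window_certificate U θ hL hn hΛ hclosed h0 hz hInj' μ ν hΛm O s B
    tt v hsh Y u b cw hcw ah dc V w a word hcert

end Window

end Summit.Ventures.CertifiedManyBodySolver.Rows
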